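import Literature.NumberTheory.LFunctions.ConreyIwaniec2002Prop64OfThetaOmega
import Literature.NumberTheory.LFunctions.ConreyIwaniec2002BesselKernel
import HarnessLib

/-!
# Conrey–Iwaniec (2002), Proposition 6.4 modulo the theta `ω`-relation alone

B. Conrey, H. Iwaniec, Acta Arith. 103 (2002) 259–312, Theorems 4.3/4.4 and Proposition 6.4 [held text
`paper:arxiv-math_0111012`, p0012, p0014–p0017]. With S3c — the kernel bound (4.5) for
`J₀((4π/c)√(mx/r))`, `B = B₀q^{3/2}` — now a tree theorem (`bessel_kernel`, seat ls-inputs-P64-w11), the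
registered S3 statement of SKELETON P64 and the typed `conreyIwaniec2002_proposition64` depend on ONE
remaining registered stub of the cell `landau-siegel/ls-inputs`: V1 `stub_theta_omega` of SUB-SKELETON
S3d (the `ω`-relation (2.23)–(2.39) for the class-group theta series, behind Propositions 3.2/3.3),
taken verbatim as the hypothesis. Seat ls-inputs-P64-lead g2 (integration). No claim about Landau–Siegel
zeros.

## References
* [ConreyIwaniec2002] B. Conrey, H. Iwaniec, Acta Arith. 103 (2002) 259–312: Theorems 4.3/4.4
  (4.25)–(4.26), Proposition 6.4 (6.52).
-/

noncomputable section

open scoped NumberField FourierTransform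
open Complex MeasureTheory

namespace Literature.NumberTheory.LFunctions

namespace ConreyIwaniec2002

open NumberField Literature.NumberTheory.LFunctions.NumberField
open Literature.Analysis.FunctionSpaces (besselJ)

/-- **Theorems 4.3/4.4 for `λ_ψ` (registered S3 statement of SKELETON P64, verbatim) from V1 alone.**
[cite: ConreyIwaniec2002, Theorem 4.3 (4.25), Theorem 4.4 (4.26)] -/
theorem shifted_convolution_of_theta_omega
    (hV1 :
    ∀ (q : ℕ) [NeZero q], 4 < q → Odd q → ∀ χ : DirichletCharacter ℂ q,
      χ.IsPrimitive → χ.IsQuadratic → χ.Odd →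
        ∀ (K : Type) [Field K] [NumberField K],
          Module.finrank ℚ K = 2 → NumberField.discr K = -(q : ℤ) →
            ∀ (ψ : ClassGroup (𝓞 K) →* ℂˣ) (c : ℕ), 1 ≤ c →
              ∃ ψ' : ClassGroup (𝓞 K) →* ℂˣ, IsGenusCharFor (ψ' * ψ⁻¹) (Nat.gcd c q) ∧
                ∀ a abar : ℤ, a * abar ≡ 1 [ZMOD c] →
                  ∃ η : ℂ, ‖η‖ = 1 ∧
                    IsOmegaRelated ((c : ℝ) * Real.sqrt (q / Nat.gcd c q : ℕ)) η
                      (twistCount K (classGroupCharIdealHom ψ))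
                      (twistCount K (classGroupCharIdealHom ψ'))
                      (thetaConst K ψ) (thetaConst K ψ')
                      ((a : ℝ) / c)
                      (-((abar * ((((q / Nat.gcd c q : ℕ) : ZMod c)⁻¹).val : ℤ) : ℤ) : ℝ) / c)) :
    ∃ c : ℝ, 0 < c ∧
      ∀ (q : ℕ) [NeZero q], 4 < q → Odd q → ∀ χ : DirichletCharacter ℂ q,
        χ.IsPrimitive → χ.IsQuadratic → χ.Odd →
          ∀ (K : Type) [Field K] [NumberField K],
            Module.finrank ℚ K = 2 → NumberField.discr K = -(q : ℤ) →
              ∀ (ψ : ClassGroup (𝓞 K) →* ℂˣ),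
                ∃ σ : ℕ → ℝ, IsCISigma q ‖χ.LFunction 1‖ σ ∧
                  ShiftedConvolutionBound (twistCount K (classGroupCharIdealHom ψ)) σ
                    (c * (q : ℝ) ^ (6 : ℕ)) :=
  shifted_convolution_of_bessel_kernel_theta_omega bessel_kernel hV1

/-- **Proposition 6.4 (typed `conreyIwaniec2002_proposition64`) from V1 `stub_theta_omega` alone.**
[cite: ConreyIwaniec2002, Proposition 6.4 (6.52)] -/
theorem proposition64_of_theta_omega
    (hV1 :
    ∀ (q : ℕ) [NeZero q], 4 < q → Odd q → ∀ χ : DirichletCharacter ℂ q,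
      χ.IsPrimitive → χ.IsQuadratic → χ.Odd →
        ∀ (K : Type) [Field K] [NumberField K],
          Module.finrank ℚ K = 2 → NumberField.discr K = -(q : ℤ) →
            ∀ (ψ : ClassGroup (𝓞 K) →* ℂˣ) (c : ℕ), 1 ≤ c →
              ∃ ψ' : ClassGroup (𝓞 K) →* ℂˣ, IsGenusCharFor (ψ' * ψ⁻¹) (Nat.gcd c q) ∧
                ∀ a abar : ℤ, a * abar ≡ 1 [ZMOD c] →
                  ∃ η : ℂ, ‖η‖ = 1 ∧
                    IsOmegaRelated ((c : ℝ) * Real.sqrt (q / Nat.gcd c q : ℕ)) η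
                      (twistCount K (classGroupCharIdealHom ψ))
                      (twistCount K (classGroupCharIdealHom ψ'))
                      (thetaConst K ψ) (thetaConst K ψ')
                      ((a : ℝ) / c)
                      (-((abar * ((((q / Nat.gcd c q : ℕ) : ZMod c)⁻¹).val : ℤ) : ℤ) : ℝ) / c)) :
    conreyIwaniec2002_proposition64 :=
  proposition64_of_bessel_kernel_theta_omega bessel_kernel hV1

end ConreyIwaniec2002

end Literature.NumberTheory.LFunctions

end
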